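import Mathlib
import Literature.LinearAlgebra.Matrix.CrossInterpolation
import Literature.LinearAlgebra.Matrix.MaximalVolumePivot

/-!
# Two-sided perturbation of a matrix cross interpolation (Savostyanov's splitting lemma)

Let `A` be an `m × n` matrix over a normed field, `r : ι → m`, `c : ι → n` pivot rows and
columns with nonsingular pivot block `P = A[r, c]`, column block `C = A[:, c]`, row block
`R = A[r, :]`, and `Ã = C P⁻¹ R = crossInterp A r c` the cross interpolation
(`Literature.LinearAlgebra.Matrix.crossInterp`).  In the accuracy analysis of tensor cross
interpolation over a dimension tree [Savostyanov2014, §3] the blocks `C` and `R` of an unfolding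
are themselves not available exactly but only through approximations `T_C ≈ C`, `T_R ≈ R`
(the interpolants of the two sub-tensors one level down the tree), and the quantity to control is
the TWO-SIDED PERTURBED SKELETON `T_C P⁻¹ T_R`.  [Savostyanov2014, §3 Lemma 2] estimates
`|C P⁻¹ R - T_C P⁻¹ T_R|` entrywise ("in the Chebyshev norm") from

* the algebraic identity `C P⁻¹ R - T_C P⁻¹ T_R = (C P⁻¹) E_R + E_C (P⁻¹ R) - E_C P⁻¹ E_R`,
  `E_C = C - T_C`, `E_R = R - T_R` [Savostyanov2014, §3 proof of Lemma 2];
* DOMINANCE of the maximum-volume pivot block in its rows and columns,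
  `|C P⁻¹| ≤ 1`, `|P⁻¹ R| ≤ 1` entrywise [Savostyanov2014, §2 eq. (dom)] (Goreinov–Oseledets–
  Savostyanov–Tyrtyshnikov–Zamarashkin 2010; [AllenLaiShen2024, Lemma 1]);

giving `|C P⁻¹ R - T_C P⁻¹ T_R| ≤ r |E_R| + r |E_C| + r² |P⁻¹| |E_C| |E_R|`, i.e. with
`|E_C|, |E_R| ≤ ε |A|` and `κ = r |A| |P⁻¹|` the printed bound `(2 + κ ε) ε r |A|`
(`r = card ι`).  Going up one level of a dimension tree the relative error therefore obeys
`ε_{l+1} ≤ (2 + κ ε_l) ε_l r + ε_1 ≤ (2 r + κ r + 1) ε_l` as long as `ε_l ≤ 1`, whence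
`ε_l ≤ (2 r + κ r + 1)^{l-1} ε_1` and, for a balanced tree over `d` leaves (`l ≤ ⌈log₂ d⌉ + 1`
levels), the factor `(2 r + κ r + 1)^{⌈log₂ d⌉}` of [Savostyanov2014, §3 Theorem 1].

This file formalises exactly these matrix-level and real-arithmetic engines:

* `crossInterp_sub_mul_inv_mul` — the identity (over any commutative ring);
* `norm_submatrix_mul_inv_apply_le_of_det_update_le`,
  `norm_inv_mul_submatrix_apply_le_of_det_update_le` — a pivot block whose volume no single
  row (column) exchange multiplies by more than `γ` has row (column) coefficients of norm `≤ γ`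
  (Cramer's rule, via `Literature.LinearAlgebra.Matrix.mul_inv_submatrix_apply_mul_det` /
  `inv_submatrix_mul_apply_mul_det`); `γ = 1` is dominance of a (locally) maximal-volume block;
* `norm_crossInterp_sub_mul_inv_mul_apply_le` — the entrywise bound with general coefficient
  bounds `γ₁, γ₂`, `|P⁻¹| ≤ β` and perturbation sizes `e₁, e₂`;
  `norm_crossInterp_sub_mul_inv_mul_apply_le_rel` — the printed form `(2 + κ ε) ε r |A|`;
  `norm_crossInterp_sub_mul_inv_mul_apply_le_of_volume_maximal` — the same from volume
  maximality of `P` under single row and column exchanges;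
* `le_pow_mul_of_levelRecursion`, `le_pow_clog_mul_of_levelRecursion` — the level recursion:
  any sequence with `e 1 ≤ ε₁`, `0 ≤ e l` and `e (l+1) ≤ (2 + κ e l) e l r + ε₁` whenever
  `e l ≤ 1` satisfies `e l ≤ (2 r + κ r + 1)^{l-1} ε₁` for `1 ≤ l ≤ L`, provided
  `(2 r + κ r + 1)^{L-1} ε₁ ≤ 1` ("`ε_1` sufficiently small"); with `L ≤ ⌈log₂ d⌉ + 1`,
  `e L ≤ (2 r + κ r + 1)^{⌈log₂ d⌉} ε₁`.

DICTIONARY (paper ↦ here): `A_k = [A(I≤k, J>k)]` ↦ `A.submatrix r c`; `B^[k] = A_k⁻¹` ↦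
`(A.submatrix r c)⁻¹`; the sub-tensors `A_1`, `A_2` (as matrices: the pivot columns, resp. pivot
rows, of the unfolding restricted to the sub-tensor) ↦ `A.submatrix id c`, `A.submatrix r id`;
their tree interpolants `T_1`, `T_2` ↦ `TC`, `TR`; `|·|` (Chebyshev norm) ↦ entrywise `‖·‖`
hypotheses and conclusions; `r_k` ↦ `Fintype.card ι`; `κ_k = r_k |A| |A_k⁻¹|` ↦ the hypothesis
`card ι * β * a ≤ κ` with `‖P⁻¹ t u‖ ≤ β`, `|A| ≤ a` implicit in `|E| ≤ ε a`; levels `ε_m` ↦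
`e m`.

NOT formalised here: the dimension-tree bookkeeping of [Savostyanov2014, §3] (which sub-tensors
are interpolated at which level, Lemma 1, and the assembly of Theorem 1 as a statement about a
`d`-tensor), the first-level estimates `ε_1 = (r+1) E_F / |A|`, `(r+1)² E_C / |A|` (maximum-volume
error bounds, see `Literature.LinearAlgebra.Matrix.MaximalVolumeErrorBounds` for the Chebyshev
one; the spectral/Frobenius one needs singular values), and anything algorithmic.

References: D. V. Savostyanov, *Quasioptimality of maximum-volume cross interpolation of tensors*,
Linear Algebra Appl. 458 (2014) 217–244, arXiv:1305.1818 (`Savostyanov2014`), §2 eq. (dom), §3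
Lemma 2 and proof of Theorem 1; K. Allen, M.-J. Lai, Z. Shen, *Maximal volume matrix cross
approximation for image compression and least squares solution*, Adv. Comput. Math. (2024),
arXiv:2309.17403 (`AllenLaiShen2024`), Lemma 1; R. A. Horn, C. R. Johnson, *Matrix Analysis*,
2nd ed., CUP 2013 (`HornJohnson2013`), §0.8.3 (Cramer's rule).

AI-produced formalisation (H21 engines group, seat eng-quad-2, 2026-08-21); no facts, no axioms
beyond Mathlib's, no `sorry`.
-/

open Matrix

namespace Literature.LinearAlgebra.Matrix

section CommRing

variable {K : Type*} [CommRing K] {m n ι : Type*} [Fintype ι] [DecidableEq ι]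

/-- [cite: Savostyanov2014, §3 Lemma 2 (proof: `A₁ B A₂ = T₁ B T₂ + A₁ B E₂ + E₁ B A₂ - E₁ B E₂`)]
THE SPLITTING IDENTITY: for any candidate factors `T_C`, `T_R`,
`C P⁻¹ R - T_C P⁻¹ T_R = (C P⁻¹) (R - T_R) + (C - T_C) (P⁻¹ R) - (C - T_C) P⁻¹ (R - T_R)`. -/
theorem crossInterp_sub_mul_inv_mul (A : Matrix m n K) (r : ι → m) (c : ι → n)
    (TC : Matrix m ι K) (TR : Matrix ι n K) :
    crossInterp A r c - TC * (A.submatrix r c)⁻¹ * TR =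
      A.submatrix id c * (A.submatrix r c)⁻¹ * (A.submatrix r id - TR)
        + (A.submatrix id c - TC) * ((A.submatrix r c)⁻¹ * A.submatrix r id)
        - (A.submatrix id c - TC) * (A.submatrix r c)⁻¹ * (A.submatrix r id - TR) := by
  simp only [crossInterp, Matrix.mul_sub, Matrix.sub_mul, Matrix.mul_assoc]
  abel

end CommRing

/-! ### Entrywise bounds over a normed field -/

section Normed

variable {K : Type*} [NormedField K] {m n ι : Type*} [Fintype ι] [DecidableEq ι]

/-- [cite: Savostyanov2014, §2 eq. (dom)]; [cite: AllenLaiShen2024, Lemma 1];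
[cite: HornJohnson2013, §0.8.3]
ROW COEFFICIENTS FROM ROW-EXCHANGE VOLUMES: if no replacement of a single pivot row by a row of
`A` multiplies `‖det P‖` by more than `γ`, then `‖(C P⁻¹) i t‖ ≤ γ` (`γ = 1`: a maximal-volume
block is dominant in its columns, `|A A_k⁻¹| ≤ 1`). -/
theorem norm_submatrix_mul_inv_apply_le_of_det_update_le (A : Matrix m n K) (r : ι → m)
    (c : ι → n) (hP : IsUnit (A.submatrix r c).det) {γ : ℝ}
    (hdom : ∀ i t, ‖(A.submatrix (Function.update r t i) c).det‖ ≤ γ * ‖(A.submatrix r c).det‖)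
    (i : m) (t : ι) : ‖(A.submatrix id c * (A.submatrix r c)⁻¹) i t‖ ≤ γ := by
  have hdet : 0 < ‖(A.submatrix r c).det‖ := norm_pos_iff.mpr hP.ne_zero
  have h : (A.submatrix id c * (A.submatrix r c)⁻¹) i t * (A.submatrix r c).det =
      (A.submatrix (Function.update r t i) c).det :=
    mul_inv_submatrix_apply_mul_det (A.submatrix id c) r hP i t
  have key : ‖(A.submatrix id c * (A.submatrix r c)⁻¹) i t‖ * ‖(A.submatrix r c).det‖ ≤
      γ * ‖(A.submatrix r c).det‖ := by
    rw [← norm_mul, h]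
    exact hdom i t
  exact le_of_mul_le_mul_right key hdet

/-- [cite: Savostyanov2014, §2 eq. (dom)]; [cite: AllenLaiShen2024, Lemma 1];
[cite: HornJohnson2013, §0.8.3]
COLUMN COEFFICIENTS FROM COLUMN-EXCHANGE VOLUMES: if no replacement of a single pivot column by a
column of `A` multiplies `‖det P‖` by more than `γ`, then `‖(P⁻¹ R) t j‖ ≤ γ` (`γ = 1`:
`|A_k⁻¹ A| ≤ 1`). -/
theorem norm_inv_mul_submatrix_apply_le_of_det_update_le (A : Matrix m n K) (r : ι → m)
    (c : ι → n) (hP : IsUnit (A.submatrix r c).det) {γ : ℝ}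
    (hdom : ∀ t j, ‖(A.submatrix r (Function.update c t j)).det‖ ≤ γ * ‖(A.submatrix r c).det‖)
    (t : ι) (j : n) : ‖((A.submatrix r c)⁻¹ * A.submatrix r id) t j‖ ≤ γ := by
  have hdet : 0 < ‖(A.submatrix r c).det‖ := norm_pos_iff.mpr hP.ne_zero
  have h : ((A.submatrix r c)⁻¹ * A.submatrix r id) t j * (A.submatrix r c).det =
      (A.submatrix r (Function.update c t j)).det :=
    inv_submatrix_mul_apply_mul_det (A.submatrix r id) c hP t j
  have key : ‖((A.submatrix r c)⁻¹ * A.submatrix r id) t j‖ * ‖(A.submatrix r c).det‖ ≤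
      γ * ‖(A.submatrix r c).det‖ := by
    rw [← norm_mul, h]
    exact hdom t j
  exact le_of_mul_le_mul_right key hdet

/-- [cite: Savostyanov2014, §3 Lemma 2]
THE SPLITTING LEMMA, GENERAL COEFFICIENTS: if `‖(C P⁻¹) i t‖ ≤ γ₁`, `‖(P⁻¹ R) t j‖ ≤ γ₂`,
`‖P⁻¹ t u‖ ≤ β`, `‖C - T_C‖ ≤ e₁` and `‖R - T_R‖ ≤ e₂` entrywise, then entrywise
`‖C P⁻¹ R - T_C P⁻¹ T_R‖ ≤ r γ₁ e₂ + r e₁ γ₂ + r (r e₁ β) e₂` (`r = card ι`; the three terms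
bound `A₁ B E₂`, `E₁ B A₂`, `E₁ B E₂` of the paper). -/
theorem norm_crossInterp_sub_mul_inv_mul_apply_le (A : Matrix m n K) (r : ι → m) (c : ι → n)
    (TC : Matrix m ι K) (TR : Matrix ι n K) {γ₁ γ₂ β e₁ e₂ : ℝ}
    (hC : ∀ i t, ‖(A.submatrix id c * (A.submatrix r c)⁻¹) i t‖ ≤ γ₁)
    (hR : ∀ t j, ‖((A.submatrix r c)⁻¹ * A.submatrix r id) t j‖ ≤ γ₂)
    (hβ : ∀ t u, ‖(A.submatrix r c)⁻¹ t u‖ ≤ β)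
    (h₁ : ∀ i t, ‖A i (c t) - TC i t‖ ≤ e₁) (h₂ : ∀ t j, ‖A (r t) j - TR t j‖ ≤ e₂)
    (i : m) (j : n) :
    ‖(crossInterp A r c - TC * (A.submatrix r c)⁻¹ * TR) i j‖ ≤
      Fintype.card ι * (γ₁ * e₂) + Fintype.card ι * (e₁ * γ₂)
        + Fintype.card ι * (Fintype.card ι * (e₁ * β) * e₂) := by
  have h₁' : ∀ i t, ‖(A.submatrix id c - TC) i t‖ ≤ e₁ := fun i t => by
    simpa using h₁ i t
  have h₂' : ∀ t j, ‖(A.submatrix r id - TR) t j‖ ≤ e₂ := fun t j => by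
    simpa using h₂ t j
  -- `A₁ B E₂`
  have T1 : ‖(A.submatrix id c * (A.submatrix r c)⁻¹ * (A.submatrix r id - TR)) i j‖ ≤
      Fintype.card ι * (γ₁ * e₂) := by
    rw [Matrix.mul_apply]
    calc ‖∑ t, (A.submatrix id c * (A.submatrix r c)⁻¹) i t * (A.submatrix r id - TR) t j‖
        ≤ ∑ t, ‖(A.submatrix id c * (A.submatrix r c)⁻¹) i t * (A.submatrix r id - TR) t j‖ :=
          norm_sum_le _ _
      _ ≤ ∑ _t : ι, γ₁ * e₂ := Finset.sum_le_sum fun t _ => by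
          rw [norm_mul]
          exact mul_le_mul (hC i t) (h₂' t j) (norm_nonneg _) ((norm_nonneg _).trans (hC i t))
      _ = Fintype.card ι * (γ₁ * e₂) := by simp
  -- `E₁ B A₂`
  have T2 : ‖((A.submatrix id c - TC) * ((A.submatrix r c)⁻¹ * A.submatrix r id)) i j‖ ≤
      Fintype.card ι * (e₁ * γ₂) := by
    rw [Matrix.mul_apply]
    calc ‖∑ t, (A.submatrix id c - TC) i t * ((A.submatrix r c)⁻¹ * A.submatrix r id) t j‖
        ≤ ∑ t, ‖(A.submatrix id c - TC) i t * ((A.submatrix r c)⁻¹ * A.submatrix r id) t j‖ :=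
          norm_sum_le _ _
      _ ≤ ∑ _t : ι, e₁ * γ₂ := Finset.sum_le_sum fun t _ => by
          rw [norm_mul]
          exact mul_le_mul (h₁' i t) (hR t j) (norm_nonneg _) ((norm_nonneg _).trans (h₁' i t))
      _ = Fintype.card ι * (e₁ * γ₂) := by simp
  -- `E₁ B E₂`
  have inner : ∀ u, ‖((A.submatrix id c - TC) * (A.submatrix r c)⁻¹) i u‖ ≤
      Fintype.card ι * (e₁ * β) := by
    intro u
    rw [Matrix.mul_apply]
    calc ‖∑ t, (A.submatrix id c - TC) i t * (A.submatrix r c)⁻¹ t u‖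
        ≤ ∑ t, ‖(A.submatrix id c - TC) i t * (A.submatrix r c)⁻¹ t u‖ := norm_sum_le _ _
      _ ≤ ∑ _t : ι, e₁ * β := Finset.sum_le_sum fun t _ => by
          rw [norm_mul]
          exact mul_le_mul (h₁' i t) (hβ t u) (norm_nonneg _) ((norm_nonneg _).trans (h₁' i t))
      _ = Fintype.card ι * (e₁ * β) := by simp
  have T3 : ‖((A.submatrix id c - TC) * (A.submatrix r c)⁻¹ * (A.submatrix r id - TR)) i j‖ ≤
      Fintype.card ι * (Fintype.card ι * (e₁ * β) * e₂) := by
    rw [Matrix.mul_apply]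
    calc ‖∑ u, ((A.submatrix id c - TC) * (A.submatrix r c)⁻¹) i u *
            (A.submatrix r id - TR) u j‖
        ≤ ∑ u, ‖((A.submatrix id c - TC) * (A.submatrix r c)⁻¹) i u *
            (A.submatrix r id - TR) u j‖ := norm_sum_le _ _
      _ ≤ ∑ _u : ι, Fintype.card ι * (e₁ * β) * e₂ := Finset.sum_le_sum fun u _ => by
          rw [norm_mul]
          exact mul_le_mul (inner u) (h₂' u j) (norm_nonneg _) ((norm_nonneg _).trans (inner u))
      _ = Fintype.card ι * (Fintype.card ι * (e₁ * β) * e₂) := by simp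
  rw [crossInterp_sub_mul_inv_mul, Matrix.sub_apply, Matrix.add_apply]
  exact (norm_sub_le _ _).trans (add_le_add ((norm_add_le _ _).trans (add_le_add T1 T2)) T3)

/-- [cite: Savostyanov2014, §3 Lemma 2]
THE SPLITTING LEMMA AS PRINTED: if `P` is dominant in its rows and columns (`‖C P⁻¹‖ ≤ 1`,
`‖P⁻¹ R‖ ≤ 1`), `‖P⁻¹‖ ≤ β` with `r β a ≤ κ` (Savostyanov's `κ = r |A| |A_k⁻¹|` for `a = |A|`),
and `‖C - T_C‖, ‖R - T_R‖ ≤ ε a` entrywise, then entrywise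
`‖C P⁻¹ R - T_C P⁻¹ T_R‖ ≤ (2 + κ ε) ε r a`. -/
theorem norm_crossInterp_sub_mul_inv_mul_apply_le_rel (A : Matrix m n K) (r : ι → m) (c : ι → n)
    (TC : Matrix m ι K) (TR : Matrix ι n K) {ε a β κ : ℝ} (hε : 0 ≤ ε) (ha : 0 ≤ a)
    (hC : ∀ i t, ‖(A.submatrix id c * (A.submatrix r c)⁻¹) i t‖ ≤ 1)
    (hR : ∀ t j, ‖((A.submatrix r c)⁻¹ * A.submatrix r id) t j‖ ≤ 1)
    (hβ : ∀ t u, ‖(A.submatrix r c)⁻¹ t u‖ ≤ β) (hκ : Fintype.card ι * β * a ≤ κ)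
    (h₁ : ∀ i t, ‖A i (c t) - TC i t‖ ≤ ε * a) (h₂ : ∀ t j, ‖A (r t) j - TR t j‖ ≤ ε * a)
    (i : m) (j : n) :
    ‖(crossInterp A r c - TC * (A.submatrix r c)⁻¹ * TR) i j‖ ≤
      (2 + κ * ε) * ε * Fintype.card ι * a := by
  have h := norm_crossInterp_sub_mul_inv_mul_apply_le A r c TC TR hC hR hβ h₁ h₂ i j
  refine h.trans ?_
  have hk : (0 : ℝ) ≤ Fintype.card ι := Nat.cast_nonneg _
  have h3 : (Fintype.card ι : ℝ) * (Fintype.card ι * (ε * a * β) * (ε * a)) ≤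
      Fintype.card ι * (κ * ε * (ε * a)) := by
    refine mul_le_mul_of_nonneg_left ?_ hk
    refine mul_le_mul_of_nonneg_right ?_ (mul_nonneg hε ha)
    calc (Fintype.card ι : ℝ) * (ε * a * β) = Fintype.card ι * β * a * ε := by ring
      _ ≤ κ * ε := mul_le_mul_of_nonneg_right hκ hε
  have e : (2 + κ * ε) * ε * Fintype.card ι * a =
      Fintype.card ι * (1 * (ε * a)) + Fintype.card ι * (ε * a * 1)
        + Fintype.card ι * (κ * ε * (ε * a)) := by
    ring
  rw [e]
  linarith

/-- [cite: Savostyanov2014, §3 Lemma 2]; [cite: Savostyanov2014, §2 eq. (dom)]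
THE SPLITTING LEMMA FROM VOLUME MAXIMALITY: if `‖det P‖` does not increase under any single
exchange of a pivot row for a row of `A` or of a pivot column for a column of `A` (in particular
if `P` is a maximal-volume `r × r` submatrix of `A`), then with `‖P⁻¹‖ ≤ β`, `r β a ≤ κ` and
`‖C - T_C‖, ‖R - T_R‖ ≤ ε a` entrywise, `‖C P⁻¹ R - T_C P⁻¹ T_R‖ ≤ (2 + κ ε) ε r a` entrywise. -/
theorem norm_crossInterp_sub_mul_inv_mul_apply_le_of_volume_maximal (A : Matrix m n K)
    (r : ι → m) (c : ι → n) (hP : IsUnit (A.submatrix r c).det)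
    (hrow : ∀ i t, ‖(A.submatrix (Function.update r t i) c).det‖ ≤ ‖(A.submatrix r c).det‖)
    (hcol : ∀ t j, ‖(A.submatrix r (Function.update c t j)).det‖ ≤ ‖(A.submatrix r c).det‖)
    (TC : Matrix m ι K) (TR : Matrix ι n K) {ε a β κ : ℝ} (hε : 0 ≤ ε) (ha : 0 ≤ a)
    (hβ : ∀ t u, ‖(A.submatrix r c)⁻¹ t u‖ ≤ β) (hκ : Fintype.card ι * β * a ≤ κ)
    (h₁ : ∀ i t, ‖A i (c t) - TC i t‖ ≤ ε * a) (h₂ : ∀ t j, ‖A (r t) j - TR t j‖ ≤ ε * a)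
    (i : m) (j : n) :
    ‖(crossInterp A r c - TC * (A.submatrix r c)⁻¹ * TR) i j‖ ≤
      (2 + κ * ε) * ε * Fintype.card ι * a :=
  norm_crossInterp_sub_mul_inv_mul_apply_le_rel A r c TC TR hε ha
    (norm_submatrix_mul_inv_apply_le_of_det_update_le A r c hP
      (fun i t => by rw [one_mul]; exact hrow i t))
    (norm_inv_mul_submatrix_apply_le_of_det_update_le A r c hP
      (fun t j => by rw [one_mul]; exact hcol t j))
    hβ hκ h₁ h₂ i j

end Normed

/-! ### The level recursion of the dimension tree -/

section LevelRecursion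

/-- [cite: Savostyanov2014, §3 Theorem 1 (proof, `ε_l = (2r + κr + 1)^{l-1} ε_1`)]
THE LEVEL RECURSION: let `e l` be the relative (Chebyshev) error at level `l` of the dimension
tree, `e 1 ≤ ε₁`, `0 ≤ e l`, and suppose one level up it obeys the splitting-lemma recursion
`e (l+1) ≤ (2 + κ e l) e l r + ε₁` whenever `e l ≤ 1`.  If `(2r + κr + 1)^{L-1} ε₁ ≤ 1`
("`ε₁` sufficiently small" for `L` levels) then `e l ≤ (2r + κr + 1)^{l-1} ε₁` for all
`1 ≤ l ≤ L`. -/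
theorem le_pow_mul_of_levelRecursion {r κ ε₁ : ℝ} (hr : 0 ≤ r) (hκ : 0 ≤ κ) (hε₁ : 0 ≤ ε₁)
    (e : ℕ → ℝ) (he₀ : ∀ l, 1 ≤ l → 0 ≤ e l) (he₁ : e 1 ≤ ε₁)
    (hstep : ∀ l, 1 ≤ l → e l ≤ 1 → e (l + 1) ≤ (2 + κ * e l) * e l * r + ε₁)
    {L : ℕ} (hL : (2 * r + κ * r + 1) ^ (L - 1) * ε₁ ≤ 1) :
    ∀ l, 1 ≤ l → l ≤ L → e l ≤ (2 * r + κ * r + 1) ^ (l - 1) * ε₁ := by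
  set G : ℝ := 2 * r + κ * r + 1 with hG
  have hG₁ : 1 ≤ G := by
    rw [hG]
    nlinarith [mul_nonneg hκ hr]
  intro l hl
  induction l, hl using Nat.le_induction with
  | base =>
    intro _
    simpa using he₁
  | succ l hl ih =>
    intro hlL
    have ihl : e l ≤ G ^ (l - 1) * ε₁ := ih (Nat.le_of_succ_le hlL)
    have hpow : G ^ (l - 1) * ε₁ ≤ G ^ (L - 1) * ε₁ :=
      mul_le_mul_of_nonneg_right (pow_le_pow_right₀ hG₁ (by omega)) hε₁
    have hel₁ : e l ≤ 1 := ihl.trans (hpow.trans hL)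
    have hel₀ : 0 ≤ e l := he₀ l hl
    have hs := hstep l hl hel₁
    have h2 : (2 + κ * e l) * e l * r ≤ (2 + κ) * e l * r := by
      refine mul_le_mul_of_nonneg_right ?_ hr
      refine mul_le_mul_of_nonneg_right ?_ hel₀
      linarith [mul_le_mul_of_nonneg_left hel₁ hκ]
    have h3 : ε₁ ≤ G ^ (l - 1) * ε₁ := le_mul_of_one_le_left hε₁ (one_le_pow₀ hG₁)
    have h4 : (2 + κ) * e l * r ≤ (2 + κ) * (G ^ (l - 1) * ε₁) * r := by
      refine mul_le_mul_of_nonneg_right ?_ hr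
      exact mul_le_mul_of_nonneg_left ihl (by linarith)
    have e1 : G ^ (l + 1 - 1) * ε₁ = (2 + κ) * (G ^ (l - 1) * ε₁) * r + G ^ (l - 1) * ε₁ := by
      have hl1 : l + 1 - 1 = (l - 1) + 1 := by omega
      rw [hl1, pow_succ, hG]
      ring
    rw [e1]
    linarith

/-- [cite: Savostyanov2014, §3 Theorem 1 (proof, balanced tree: `l ≤ log₂ d + 1`)]
THE TOP OF A BALANCED TREE: under the hypotheses of `le_pow_mul_of_levelRecursion`, if the
number of levels satisfies `L ≤ ⌈log₂ d⌉ + 1` then the error at the top level is at most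
`(2r + κr + 1)^{⌈log₂ d⌉} ε₁` — the amplification factor of [Savostyanov2014, Theorem 1]. -/
theorem le_pow_clog_mul_of_levelRecursion {r κ ε₁ : ℝ} (hr : 0 ≤ r) (hκ : 0 ≤ κ)
    (hε₁ : 0 ≤ ε₁) (e : ℕ → ℝ) (he₀ : ∀ l, 1 ≤ l → 0 ≤ e l) (he₁ : e 1 ≤ ε₁)
    (hstep : ∀ l, 1 ≤ l → e l ≤ 1 → e (l + 1) ≤ (2 + κ * e l) * e l * r + ε₁)
    {L d : ℕ} (hL₁ : 1 ≤ L) (hLd : L ≤ Nat.clog 2 d + 1)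
    (hL : (2 * r + κ * r + 1) ^ (L - 1) * ε₁ ≤ 1) :
    e L ≤ (2 * r + κ * r + 1) ^ Nat.clog 2 d * ε₁ := by
  have hG₁ : (1 : ℝ) ≤ 2 * r + κ * r + 1 := by nlinarith [mul_nonneg hκ hr]
  refine (le_pow_mul_of_levelRecursion hr hκ hε₁ e he₀ he₁ hstep hL L hL₁ le_rfl).trans ?_
  exact mul_le_mul_of_nonneg_right (pow_le_pow_right₀ hG₁ (by omega)) hε₁

end LevelRecursion

end Literature.LinearAlgebra.Matrix
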